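import Summits.CriticalPhenomena.PercolationContinuityZ3.Theorems.TallClusterMassBound.Negative.FalseWithoutCriticality
import Literature.Probability.Percolation.UniversalTightness
import Literature.Probability.Percolation.HalfSpaceFloorDilution

/-!
# `TallClusterMassBound` (stmt-CriticalPhenomena-0912), line `SketchIdeator4` (universal tightness):
# ARROW 1, probabilistic core — the conditional mass of a tall wall cluster is at most the typical
# maximum cluster volume of the half-box, up to a logarithm

Registered stub `stub_massLeTypicalMaxLog` of the skeleton `Cruxes/TallClusterMassBound/Lines/SketchIdeator4.lean`
(crux `…Theses.PercLowPointHalfSpace.TallClusterMassBound`, item B of route PercLowPointHalfSpace).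

For EVERY edge density `p` and every `r`:

  `M_p(r) = Σ_{x ∈ B_r} P_p(0 ↔_ℍ x, arm_ℍ(0,r)) ≤ (2 + 3e^{3/2}) · M(Λ_r) · π_p(r) · (1 + log(1/π_p(r)))`,

where `Λ_r = halfBox r = B_r ∩ ℍ`, `M(Λ_r) = typicalMax P^ℍ_p Λ_r` is Hutchcroft's typical value of the largest
cluster volume `|K_max(Λ_r)|` under bond percolation on the INDUCED half-space `P^ℍ_p = floorDilutedPercolation 3 p 1`
(a product Bernoulli measure), and `π_p(r) = P_p(arm_ℍ(0,r))`. Ingredients, all in the tree: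
* §1 the bridge `P_p = P^ℍ_p` on `conn x ∩ arm r` and on `arm r` (events determined by the pairs of points of `ℍ`,
  `floorDilutedPercolation_one_apply_eq`, `DCT16.determinedBy_openConnIn`);
* §2 surely `#{x ∈ B_r : 0 ↔_ℍ x} ≤ |K_0 ∩ Λ_r|` (an `ℍ`-open path is an open path), and the pointwise layer cake
  `N·𝟙_A ≤ T·𝟙_A + Σ_{T < n ≤ |Λ|} 𝟙{|K_0 ∩ Λ| ≥ n}`, integrated;
* §3 Hutchcroft's ROOTED UNIVERSAL TIGHTNESS `P(|K_0 ∩ Λ| ≥ αM) ≤ e^{(3-α)/2} P(|K_0 ∩ Λ| ≥ M)`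
  (`prodBernoulli_real_clusterCapIn_ge_le_exp_mul`, Hutchcroft 2021 Thm 2.2) ⇒ `P(|K_0 ∩ Λ| ≥ n) ≤ e^{3/2} e^{-n/(2M)}`
  for `n ≥ M`, and the geometric tail `Σ_{n > T} ≤ e^{3/2} e^{-T/(2M)} (1 + 2M)` for `T ≥ M`;
* §4 the choice `T = M + ⌈2M log(1/π)⌉` (`e^{-T/(2M)} ≤ π`) and the assembly; the constant uses `M ≥ 2`.
No criticality, no arm estimate and no wall geometry enter: the conditioning on the rare event `arm_ℍ(0,r)` costs a
logarithm, nothing else (Disproof `tallClusterMassBound_false_without_criticality` is honoured — at `p = 1` the bound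
holds with `M(Λ_r) = |Λ_r| + 1`).
-/

noncomputable section

open MeasureTheory Finset Filter
open Literature.Probability.Percolation Literature.Probability.LatticeModels
open Summit.CriticalPhenomena.PercolationContinuityZ3.Theorems.TallClusterMassBound.Negative

namespace Summit.CriticalPhenomena.PercolationContinuityZ3.Theorems.TallClusterMassBound.TightnessLine

/-! ## §1 The bridge `P_p = P^ℍ_{p}` on the events of the crux -/

/-- `{0 ↔_ℍ x}` is determined by the pairs of points of `ℍ`. [folklore] -/
theorem determinedBy_conn (x : V3) : DeterminedBy (conn x) {z : V3 | 0 ≤ z 0}.sym2 :=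
  DCT16.determinedBy_openConnIn Hs 0 x subset_rfl

/-- `arm_ℍ(0,r)` is determined by the pairs of points of `ℍ`. [folklore] -/
theorem determinedBy_arm (r : ℕ) : DeterminedBy (arm r) {z : V3 | 0 ≤ z 0}.sym2 := by
  rw [determinedBy_iff]
  intro ω ω' h
  simp only [arm, Set.mem_setOf_eq]
  exact exists_congr fun y => and_congr_right fun _ =>
    (determinedBy_iff _ _).1 (DCT16.determinedBy_openConnIn Hs 0 y subset_rfl) ω ω' h

/-- **Bridge**: `P_p(0 ↔_ℍ x, arm_r) = P^ℍ_p(0 ↔_ℍ x, arm_r)` (bond percolation on the induced half-space,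
`floorDilutedPercolation 3 p 1`). [folklore] -/
theorem real_conn_inter_arm_eq_floorDiluted (p : unitInterval) (x : V3) (r : ℕ) :
    (Pp p).real (conn x ∩ arm r) = (floorDilutedPercolation 3 p 1).real (conn x ∩ arm r) := by
  rw [measureReal_def, measureReal_def,
    floorDilutedPercolation_one_apply_eq p ((determinedBy_conn x).inter (determinedBy_arm r))
      ((measurableSet_conn x).inter (measurableSet_arm r))]
  rfl

/-- **Bridge**: `π_p(r) = P^ℍ_p(arm_r)`. [folklore] -/
theorem armProb_eq_floorDiluted (p : unitInterval) (r : ℕ) :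
    armProb p r = (floorDilutedPercolation 3 p 1).real (arm r) := by
  rw [armProb, measureReal_def, measureReal_def,
    floorDilutedPercolation_one_apply_eq p (determinedBy_arm r) (measurableSet_arm r)]
  rfl

/-- The half-box is nonempty (`up 0 = 0 ∈ Λ_r`). [folklore] -/
theorem halfBox_nonempty (r : ℕ) : (halfBox r).Nonempty :=
  ⟨up 0, cube_subset_halfBox r (up_mem_cube (Nat.zero_le r))⟩

/-! ## §2 Pointwise: the conditional mass counts vertices of `K_0 ∩ Λ_r`; layer cake -/

open scoped Classical in
/-- Surely, `#{x ∈ B_r : 0 ↔_ℍ x} ≤ |K_0 ∩ Λ_r|` (an `ℍ`-open path ends in `ℍ` and is an open path). [folklore] -/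
theorem card_filter_conn_le_clusterCapIn (ω : BondConfig V3) (r : ℕ) :
    ((box 3 r).filter fun x => ω ∈ conn x).card ≤ clusterCapIn (halfBox r) ω 0 := by
  classical
  rw [clusterCapIn_eq]
  refine Finset.card_le_card fun x hx => ?_
  rw [Finset.mem_filter] at hx ⊢
  obtain ⟨hxbox, hconn⟩ := hx
  have hxH : x ∈ Hs := by
    obtain ⟨-, hy, -⟩ := hconn
    exact hy
  refine ⟨?_, (mem_conn_iff.1 hconn).mono inf_le_left⟩
  rw [halfBox, Finset.mem_filter]
  exact ⟨hxbox, hxH⟩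

/-- Pointwise layer cake with a threshold `T`:
`Σ_{x ∈ B_r} 𝟙{0 ↔_ℍ x, arm_r} ≤ T 𝟙{arm_r} + Σ_{n = T+1}^{|Λ_r|} 𝟙{|K_0 ∩ Λ_r| ≥ n}`. [folklore] -/
theorem sum_indicator_conn_inter_arm_le (ω : BondConfig V3) (r T : ℕ) :
    ∑ x ∈ box 3 r, (conn x ∩ arm r).indicator (1 : BondConfig V3 → ℝ) ω ≤
      (T : ℝ) * (arm r).indicator (1 : BondConfig V3 → ℝ) ω +
        ∑ n ∈ Finset.Ico (T + 1) ((halfBox r).card + 1),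
          ({ω' | n ≤ clusterCapIn (halfBox r) ω' 0}).indicator (1 : BondConfig V3 → ℝ) ω := by
  classical
  have hnn : 0 ≤ ∑ n ∈ Finset.Ico (T + 1) ((halfBox r).card + 1),
      ({ω' | n ≤ clusterCapIn (halfBox r) ω' 0}).indicator (1 : BondConfig V3 → ℝ) ω :=
    Finset.sum_nonneg fun n _ => Set.indicator_nonneg (fun _ _ => zero_le_one) _
  by_cases hA : ω ∈ arm r
  · have hsum : ∑ x ∈ box 3 r, (conn x ∩ arm r).indicator (1 : BondConfig V3 → ℝ) ω =
        (((box 3 r).filter fun x => ω ∈ conn x).card : ℝ) := by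
      rw [← Finset.sum_boole]
      refine Finset.sum_congr rfl fun x _ => ?_
      simp [Set.indicator_apply, hA]
    have hsum2 : ∑ n ∈ Finset.Ico (T + 1) ((halfBox r).card + 1),
        ({ω' | n ≤ clusterCapIn (halfBox r) ω' 0}).indicator (1 : BondConfig V3 → ℝ) ω =
        (((Finset.Ico (T + 1) ((halfBox r).card + 1)).filter
          fun n => n ≤ clusterCapIn (halfBox r) ω 0).card : ℝ) := by
      rw [← Finset.sum_boole]
      refine Finset.sum_congr rfl fun n _ => ?_
      simp [Set.indicator_apply]
    rw [hsum, hsum2, Set.indicator_of_mem hA, Pi.one_apply, mul_one]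
    set N := ((box 3 r).filter fun x => ω ∈ conn x).card with hN
    have hNX : N ≤ clusterCapIn (halfBox r) ω 0 := card_filter_conn_le_clusterCapIn ω r
    have hXL : clusterCapIn (halfBox r) ω 0 ≤ (halfBox r).card := clusterCapIn_le_card _ _ _
    by_cases hNT : N ≤ T
    · have h1 : (N : ℝ) ≤ T := by exact_mod_cast hNT
      have h2 : (0 : ℝ) ≤ (((Finset.Ico (T + 1) ((halfBox r).card + 1)).filter
          fun n => n ≤ clusterCapIn (halfBox r) ω 0).card : ℝ) := Nat.cast_nonneg _
      linarith
    · push Not at hNT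
      have hsub : Finset.Ico (T + 1) (N + 1) ⊆
          (Finset.Ico (T + 1) ((halfBox r).card + 1)).filter
            fun n => n ≤ clusterCapIn (halfBox r) ω 0 := by
        intro n hn
        rw [Finset.mem_Ico] at hn
        rw [Finset.mem_filter, Finset.mem_Ico]
        exact ⟨⟨hn.1, by omega⟩, by omega⟩
      have hcard := Finset.card_le_card hsub
      rw [Nat.card_Ico] at hcard
      have h1 : ((N + 1 - (T + 1) : ℕ) : ℝ) = N - T := by
        rw [Nat.cast_sub (by omega)]
        push_cast
        ring
      have h2 : (N : ℝ) - T ≤ (((Finset.Ico (T + 1) ((halfBox r).card + 1)).filter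
          fun n => n ≤ clusterCapIn (halfBox r) ω 0).card : ℝ) := by
        rw [← h1]
        exact_mod_cast hcard
      linarith
  · have h0 : ∑ x ∈ box 3 r, (conn x ∩ arm r).indicator (1 : BondConfig V3 → ℝ) ω = 0 :=
      Finset.sum_eq_zero fun x _ => Set.indicator_of_notMem (fun h => hA h.2) _
    rw [h0, Set.indicator_of_notMem hA, mul_zero, zero_add]
    exact hnn

/-- Integrated layer cake: for every threshold `T`,
`Σ_{x ∈ B_r} P^ℍ_p(0 ↔_ℍ x, arm_r) ≤ T · P^ℍ_p(arm_r) + Σ_{n = T+1}^{|Λ_r|} P^ℍ_p(|K_0 ∩ Λ_r| ≥ n)`. [folklore] -/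
theorem sum_real_conn_inter_arm_le (p : unitInterval) (r T : ℕ) :
    ∑ x ∈ box 3 r, (floorDilutedPercolation 3 p 1).real (conn x ∩ arm r) ≤
      T * (floorDilutedPercolation 3 p 1).real (arm r) +
        ∑ n ∈ Finset.Ico (T + 1) ((halfBox r).card + 1),
          (floorDilutedPercolation 3 p 1).real {ω | n ≤ clusterCapIn (halfBox r) ω 0} := by
  classical
  set μ := floorDilutedPercolation 3 p 1 with hμ
  have hA := measurableSet_arm r
  have hC := measurableSet_conn
  have hX : ∀ n : ℕ, MeasurableSet {ω : BondConfig V3 | n ≤ clusterCapIn (halfBox r) ω 0} :=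
    fun n => measurableSet_clusterCapIn_ge _ _ _
  have hint0 : Integrable (fun ω => ∑ x ∈ box 3 r,
      (conn x ∩ arm r).indicator (1 : BondConfig V3 → ℝ) ω) μ :=
    integrable_finsetSum _ fun x _ => (integrable_const (1 : ℝ)).indicator ((hC x).inter hA)
  have hint1 : Integrable (fun ω => (T : ℝ) * (arm r).indicator (1 : BondConfig V3 → ℝ) ω) μ :=
    ((integrable_const (1 : ℝ)).indicator hA).const_mul _
  have hint2 : Integrable (fun ω => ∑ n ∈ Finset.Ico (T + 1) ((halfBox r).card + 1),
      ({ω' | n ≤ clusterCapIn (halfBox r) ω' 0}).indicator (1 : BondConfig V3 → ℝ) ω) μ :=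
    integrable_finsetSum _ fun n _ => (integrable_const (1 : ℝ)).indicator (hX n)
  calc ∑ x ∈ box 3 r, μ.real (conn x ∩ arm r)
      = ∫ ω, ∑ x ∈ box 3 r, (conn x ∩ arm r).indicator (1 : BondConfig V3 → ℝ) ω ∂μ := by
        rw [integral_finsetSum]
        · exact Finset.sum_congr rfl fun x _ => (integral_indicator_one ((hC x).inter hA)).symm
        · intro x _
          exact (integrable_const (1 : ℝ)).indicator ((hC x).inter hA)
    _ ≤ ∫ ω, ((T : ℝ) * (arm r).indicator (1 : BondConfig V3 → ℝ) ω +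
          ∑ n ∈ Finset.Ico (T + 1) ((halfBox r).card + 1),
            ({ω' | n ≤ clusterCapIn (halfBox r) ω' 0}).indicator (1 : BondConfig V3 → ℝ) ω) ∂μ :=
        integral_mono hint0 (hint1.add hint2) fun ω => sum_indicator_conn_inter_arm_le ω r T
    _ = T * μ.real (arm r) + ∑ n ∈ Finset.Ico (T + 1) ((halfBox r).card + 1),
          μ.real {ω | n ≤ clusterCapIn (halfBox r) ω 0} := by
        rw [integral_add hint1 hint2, integral_const_mul, integral_indicator_one hA, integral_finsetSum]
        · congr 1
          exact Finset.sum_congr rfl fun n _ => integral_indicator_one (hX n)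
        · intro n _
          exact (integrable_const (1 : ℝ)).indicator (hX n)

/-! ## §3 Universal tightness: the tail of `|K_0 ∩ Λ_r|` above the typical maximum -/

/-- **Rooted universal tightness, exponential form**: for `n ≥ M = typicalMax P^ℍ_p Λ_r`,
`P^ℍ_p(|K_0 ∩ Λ_r| ≥ n) ≤ e^{3/2} (e^{-1/(2M)})^n` (Hutchcroft 2021, Thm 2.2 (2.5), tree
`prodBernoulli_real_clusterCapIn_ge_le_exp_mul` with `α = n/M`). [folklore] -/
theorem real_clusterCapIn_ge_le_exp (p : unitInterval) {r n : ℕ}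
    (hn : typicalMax (floorDilutedPercolation 3 p 1) (halfBox r) ≤ n) :
    (floorDilutedPercolation 3 p 1).real {ω | n ≤ clusterCapIn (halfBox r) ω 0} ≤
      Real.exp (3 / 2) *
        Real.exp (-1 / (2 * typicalMax (floorDilutedPercolation 3 p 1) (halfBox r))) ^ n := by
  have hμ : floorDilutedPercolation 3 p 1 = prodBernoulli (floorDilutedParam 3 p 1) := rfl
  rw [hμ] at hn ⊢
  set μ := prodBernoulli (floorDilutedParam 3 p 1) with hμdef
  set M := typicalMax μ (halfBox r) with hMdef
  have hM2 : 2 ≤ M := two_le_typicalMax μ (halfBox_nonempty r)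
  have hMR : (2 : ℝ) ≤ M := by exact_mod_cast hM2
  have hM0 : (0 : ℝ) < M := by linarith
  have hα : (1 : ℝ) ≤ n / M := by
    rw [le_div_iff₀ hM0, one_mul]
    exact_mod_cast hn
  have key := prodBernoulli_real_clusterCapIn_ge_le_exp_mul (floorDilutedParam 3 p 1)
    (halfBox_nonempty r) (0 : V3) hα
  have hsub : {ω : BondConfig V3 | n ≤ clusterCapIn (halfBox r) ω 0} ⊆
      {ω | (n : ℝ) / M * M ≤ (clusterCapIn (halfBox r) ω 0 : ℝ)} := by
    intro ω hω
    simp only [Set.mem_setOf_eq] at hω ⊢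
    rw [div_mul_cancel₀ _ hM0.ne']
    exact_mod_cast hω
  calc μ.real {ω | n ≤ clusterCapIn (halfBox r) ω 0}
      ≤ μ.real {ω | (n : ℝ) / M * M ≤ (clusterCapIn (halfBox r) ω 0 : ℝ)} :=
        measureReal_mono hsub (measure_ne_top _ _)
    _ ≤ Real.exp ((3 - n / M) / 2) * μ.real {ω | M ≤ clusterCapIn (halfBox r) ω 0} := key
    _ ≤ Real.exp ((3 - n / M) / 2) * 1 :=
        mul_le_mul_of_nonneg_left measureReal_le_one (Real.exp_pos _).le
    _ = Real.exp (3 / 2) * Real.exp (-1 / (2 * M)) ^ n := by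
        rw [mul_one, ← Real.exp_nat_mul, ← Real.exp_add]
        congr 1
        field_simp
        ring

/-- **Geometric tail**: for `T ≥ M`,
`Σ_{n = T+1}^{|Λ_r|} P^ℍ_p(|K_0 ∩ Λ_r| ≥ n) ≤ e^{3/2} (e^{-1/(2M)})^T (1 + 2M)` (`1/(1 - e^{-1/(2M)}) ≤ 1 + 2M`). [folklore] -/
theorem sum_Ico_real_clusterCapIn_ge_le (p : unitInterval) (r : ℕ) {T : ℕ}
    (hT : typicalMax (floorDilutedPercolation 3 p 1) (halfBox r) ≤ T) :
    ∑ n ∈ Finset.Ico (T + 1) ((halfBox r).card + 1),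
        (floorDilutedPercolation 3 p 1).real {ω | n ≤ clusterCapIn (halfBox r) ω 0} ≤
      Real.exp (3 / 2) *
        Real.exp (-1 / (2 * typicalMax (floorDilutedPercolation 3 p 1) (halfBox r))) ^ T *
          (1 + 2 * typicalMax (floorDilutedPercolation 3 p 1) (halfBox r)) := by
  set μ := floorDilutedPercolation 3 p 1 with hμ
  set M := typicalMax μ (halfBox r) with hMdef
  have hM2 : 2 ≤ M := two_le_typicalMax μ (halfBox_nonempty r)
  have hMR : (2 : ℝ) ≤ M := by exact_mod_cast hM2
  have hM0 : (0 : ℝ) < M := by linarith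
  set ρ := Real.exp (-1 / (2 * M)) with hρ
  have hρ0 : 0 ≤ ρ := (Real.exp_pos _).le
  have hρ1 : ρ < 1 := Real.exp_lt_one_iff.2 (by
    rw [neg_div]
    exact neg_neg_of_pos (by positivity))
  have hterm : ∀ n ∈ Finset.Ico (T + 1) ((halfBox r).card + 1),
      μ.real {ω | n ≤ clusterCapIn (halfBox r) ω 0} ≤ Real.exp (3 / 2) * ρ ^ n := by
    intro n hn
    have hMn : M ≤ n := by
      have := (Finset.mem_Ico.1 hn).1
      omega
    exact real_clusterCapIn_ge_le_exp p hMn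
  have h1r : 0 < 1 - ρ := by linarith
  have hinv : 1 / (1 - ρ) ≤ 1 + 2 * M := by
    have hexp : 1 + 1 / (2 * (M : ℝ)) ≤ Real.exp (1 / (2 * M)) := by
      have := Real.add_one_le_exp (1 / (2 * (M : ℝ)))
      linarith
    have hr' : ρ * Real.exp (1 / (2 * M)) = 1 := by
      rw [hρ, ← Real.exp_add, show -1 / (2 * (M : ℝ)) + 1 / (2 * M) = 0 by ring, Real.exp_zero]
    have hrle : ρ * (1 + 1 / (2 * M)) ≤ 1 := by
      calc ρ * (1 + 1 / (2 * M)) ≤ ρ * Real.exp (1 / (2 * M)) :=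
            mul_le_mul_of_nonneg_left hexp hρ0
        _ = 1 := hr'
    rw [div_le_iff₀ h1r]
    have : (1 + 2 * (M : ℝ)) * (1 - ρ) = 1 + 2 * M - 2 * M * (ρ * (1 + 1 / (2 * M))) := by
      field_simp
      ring
    rw [this]
    nlinarith
  calc ∑ n ∈ Finset.Ico (T + 1) ((halfBox r).card + 1), μ.real {ω | n ≤ clusterCapIn (halfBox r) ω 0}
      ≤ ∑ n ∈ Finset.Ico (T + 1) ((halfBox r).card + 1), Real.exp (3 / 2) * ρ ^ n :=
        Finset.sum_le_sum hterm
    _ = Real.exp (3 / 2) * ∑ n ∈ Finset.Ico (T + 1) ((halfBox r).card + 1), ρ ^ n := by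
        rw [Finset.mul_sum]
    _ ≤ Real.exp (3 / 2) * (ρ ^ (T + 1) / (1 - ρ)) :=
        mul_le_mul_of_nonneg_left (geom_sum_Ico_le_of_lt_one hρ0 hρ1) (Real.exp_pos _).le
    _ ≤ Real.exp (3 / 2) * (ρ ^ T / (1 - ρ)) := by
        refine mul_le_mul_of_nonneg_left (div_le_div_of_nonneg_right ?_ h1r.le) (Real.exp_pos _).le
        rw [pow_succ]
        exact mul_le_of_le_one_right (pow_nonneg hρ0 _) hρ1.le
    _ ≤ Real.exp (3 / 2) * (ρ ^ T * (1 + 2 * M)) := by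
        refine mul_le_mul_of_nonneg_left ?_ (Real.exp_pos _).le
        rw [div_eq_mul_one_div]
        exact mul_le_mul_of_nonneg_left hinv (pow_nonneg hρ0 _)
    _ = Real.exp (3 / 2) * ρ ^ T * (1 + 2 * M) := by ring

/-! ## §4 Assembly -/

/-- **ARROW 1 at every `p`**: `M_p(r) ≤ (2 + 3e^{3/2}) · M(Λ_r) · π_p(r) · (1 + log(1/π_p(r)))`, with
`M(Λ_r) = typicalMax (floorDilutedPercolation 3 p 1) (halfBox r)` (threshold `T = M + ⌈2M log(1/π)⌉`). [folklore] -/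
theorem mass_le_typicalMax_mul_log (p : unitInterval) (r : ℕ) :
    mass p r ≤ (2 + 3 * Real.exp (3 / 2)) *
      (typicalMax (floorDilutedPercolation 3 p 1) (halfBox r) : ℝ) * armProb p r *
        (1 + Real.log (1 / armProb p r)) := by
  have hmass : mass p r = ∑ x ∈ box 3 r, (floorDilutedPercolation 3 p 1).real (conn x ∩ arm r) := by
    unfold mass
    exact Finset.sum_congr rfl fun x _ => real_conn_inter_arm_eq_floorDiluted p x r
  rw [hmass, armProb_eq_floorDiluted p r]
  set μ := floorDilutedPercolation 3 p 1 with hμ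
  set M := typicalMax μ (halfBox r) with hMdef
  set π := μ.real (arm r) with hπdef
  set E := Real.exp (3 / 2) with hE
  have hE0 : 0 < E := Real.exp_pos _
  have hM2 : 2 ≤ M := two_le_typicalMax μ (halfBox_nonempty r)
  have hMR : (2 : ℝ) ≤ M := by exact_mod_cast hM2
  have hM0 : (0 : ℝ) < M := by linarith
  have hπ0 : 0 ≤ π := measureReal_nonneg
  have hπ1 : π ≤ 1 := measureReal_le_one
  rcases hπ0.eq_or_lt with hπz | hπpos
  · -- `π = 0`: both sides vanish
    have hle : ∑ x ∈ box 3 r, μ.real (conn x ∩ arm r) ≤ 0 := by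
      calc ∑ x ∈ box 3 r, μ.real (conn x ∩ arm r) ≤ ∑ _x ∈ box 3 r, π :=
            Finset.sum_le_sum fun x _ => measureReal_mono Set.inter_subset_right (measure_ne_top _ _)
        _ = 0 := by rw [← hπz, Finset.sum_const_zero]
    have hrhs : (2 + 3 * E) * (M : ℝ) * π * (1 + Real.log (1 / π)) = 0 := by
      rw [← hπz]; ring
    linarith
  · -- `π > 0`
    set L := Real.log (1 / π) with hL
    have hL0 : 0 ≤ L := Real.log_nonneg (by rw [le_div_iff₀ hπpos]; linarith)
    set T := M + ⌈2 * (M : ℝ) * L⌉₊ with hT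
    have hTM : M ≤ T := Nat.le_add_right _ _
    have hTle : (T : ℝ) ≤ M + 2 * M * L + 1 := by
      have := Nat.ceil_lt_add_one (show 0 ≤ 2 * (M : ℝ) * L by positivity)
      rw [hT]; push_cast; linarith
    have hTge : 2 * (M : ℝ) * L ≤ T := by
      have := Nat.le_ceil (2 * (M : ℝ) * L)
      rw [hT]; push_cast; linarith
    -- the geometric factor is at most `π`
    have hρT : Real.exp (-1 / (2 * (M : ℝ))) ^ T ≤ π := by
      rw [← Real.exp_nat_mul]
      have hlog : Real.exp (-L) = π := by
        rw [hL, one_div, Real.log_inv, neg_neg, Real.exp_log hπpos]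
      rw [← hlog]
      refine Real.exp_le_exp.2 ?_
      have : (T : ℝ) * (-1 / (2 * M)) = -(T / (2 * M)) := by ring
      rw [this, neg_le_neg_iff, le_div_iff₀ (by positivity)]
      linarith
    have step1 := sum_real_conn_inter_arm_le p r T
    have step2 := sum_Ico_real_clusterCapIn_ge_le p r hTM
    have htail : ∑ n ∈ Finset.Ico (T + 1) ((halfBox r).card + 1),
        μ.real {ω | n ≤ clusterCapIn (halfBox r) ω 0} ≤ E * π * (1 + 2 * M) := by
      refine step2.trans ?_
      have h1 : 0 ≤ 1 + 2 * (M : ℝ) := by positivity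
      exact mul_le_mul_of_nonneg_right (mul_le_mul_of_nonneg_left hρT hE0.le) h1
    have hmain : ∑ x ∈ box 3 r, μ.real (conn x ∩ arm r) ≤
        (M + 2 * M * L + 1) * π + E * π * (1 + 2 * M) := by
      refine step1.trans (add_le_add ?_ htail)
      exact mul_le_mul_of_nonneg_right hTle hπ0
    have key : (2 + 3 * E) * (M : ℝ) * π * (1 + L) - ((M + 2 * M * L + 1) * π + E * π * (1 + 2 * M)) =
        π * ((M - 1) * (1 + E) + 3 * E * M * L) := by ring
    have hnonneg : 0 ≤ π * (((M : ℝ) - 1) * (1 + E) + 3 * E * M * L) := by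
      have h1 : (0 : ℝ) ≤ (M - 1) * (1 + E) := mul_nonneg (by linarith) (by linarith)
      have h2 : (0 : ℝ) ≤ 3 * E * M * L := by positivity
      exact mul_nonneg hπ0 (add_nonneg h1 h2)
    linarith

/-- **Registered stub `stub_massLeTypicalMaxLog` (ARROW 1, probabilistic core) at `p_c(ℤ³)`**:
`∃ K, ∀ r ≥ 1, M(r) ≤ K · typicalMax P^ℍ_{p_c} Λ_r · π_s(r) · (1 + log(1/π_s(r)))`. [folklore] -/
theorem stub_massLeTypicalMaxLog :
    ∃ K : ℝ, ∀ r : ℕ, 1 ≤ r →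
      mass (criticalProbI 3) r ≤
        K * (typicalMax (floorDilutedPercolation 3 (criticalProbI 3) 1) (halfBox r) : ℝ) *
          armProb (criticalProbI 3) r * (1 + Real.log (1 / armProb (criticalProbI 3) r)) :=
  ⟨2 + 3 * Real.exp (3 / 2), fun r _ => mass_le_typicalMax_mul_log (criticalProbI 3) r⟩

end Summit.CriticalPhenomena.PercolationContinuityZ3.Theorems.TallClusterMassBound.TightnessLine
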